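import Summits.ABC.IUTFork.LDHGenuinePrintIsmHexFamilyShallow
import HarnessLib

/-!
# The fork at [IUTchIII] Corollary 3.12, L-DH level — PRINT's (Ind2) on the whole HEX family `λ_k = 1/2 + 2/7^k` (`(7^k−4) + 8 = 7^k+4`,
# scaled `(7^k−4) + (7^k+4) = 2·7^k`), `1 ≤ k ≤ 16`, EVERY prime level `l ≥ 5`: the per-image / union inequality over print's `Ism`
# HOLDS IFF `k = 1 ∧ l ≤ 11` (part 3 of 3: the datum-level rows)

Record-only PROOF file (D-0012) of the abc-iut cell (seat abc-iut-c312-d1, gen 12; row «C:PRINT-ISM-HEX-FAMILY» — the print-`Ism` (Ind2) twin of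
abc-iut-C-cert-3's «C:PERIMAGE-HEX» CONTAINER rows `LDHGenuinePerImageUniformShellRowsHex{A,B,C,D}.lean` (k = 1 … 16, `T.Cor312PerImageOf` at every
genuine datum, every non-pole prime `l ≥ 7`) and of the (U) junction `Conditional.Hex.nonempty_and_cor312Of_lamSeven_le_six_tabulated` (p504944
lineage)). TAKES NO SIDE on [IUTchIII] Cor. 3.12.

With (Ind2) := PRINT's factorwise `Ism(G_{v̲})` AS TYPED by abc-iut-c312-1 (`Real.ismIsm`), part 7 of «C:PERIMAGE-PRINT-ISM» (p516974) proved: at a genuine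
Θ-volume datum `T` of `(P, l)`, `λ_P ∈ U`, and for every print-dominated family `H` of packet automorphisms, the per-image inequality
`−|log q| ≤ Σ_p ln νL_p(hull(⋃_{g∈H} g·P_Θ)) + ((l+5)/4)·log π` (reading (P)), resp. its union/symmetrised form (reading (U), rational `j`), holds
IFF the Szpiro-SHALLOW inequality `((l+1)/24 − 1/(2l))·log q^{∤{2,l}}(λ_P) ≤ ((l+5)/4)·log π` holds. Parts 1–2 (`LDHGenuinePrintIsmHexFamilyBounds.lean`,
`LDHGenuinePrintIsmHexFamilyShallow.lean`) decide that inequality on the HEX family at every prime `l ≥ 5`: FALSE for all `2 ≤ k ≤ 16`; at `k = 1` TRUE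
iff `l ≤ 11`. Hence, BY NAME:

* **`HexPrintIsm.not_perImage_printInd2_lamSeven`** / **`HexPrintIsm.not_union_printInd2_lamSeven`** — for EVERY `2 ≤ k ≤ 16`, EVERY `l ≥ 5`, EVERY
  genuine Θ-volume datum `T` over `ratPoint (1/2 + 2/7^k)` at level `l` and EVERY print-dominated `H`: the per-image inequality (P) over print's
  (Ind2) FAILS, and the union inequality (U) over print's (Ind2) FAILS;
* **`HexPrintIsm.perImage_printInd2_hexOne_iff`** / **`HexPrintIsm.union_printInd2_hexOne_iff`** — `k = 1` (`λ = 11/14`): for every `l ≥ 5`, every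
  datum and every print-dominated `H`, the (P)- resp. (U)-inequality over print's (Ind2) holds IFF `l ≤ 11`;
* **`HexPrintIsm.nonempty_and_not_union_printInd2_lamSeven_tabulated`** — NON-VACUITY: for `2 ≤ k ≤ 6` and each of the 24 TABULATED levels
  `11 ≤ l ≤ 107` of the junction of record, the datum type IS INHABITED ∧ the (U)-inequality over print's (Ind2) fails for every datum and every
  print-dominated `H` — at the very rows where the junction proves the CONTAINER reading `T.Cor312Of` for every datum.

CENSUS WORDS (numbers about OUR typings; no side). On the HEX family `k ≤ 16` the two typings of (Ind2) part ways completely: the Dupuy–Hilado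
CONTAINER reading is a theorem at every genuine datum of every row `k ≤ 16` (reading (P): C-cert-3's uniform shell rows, non-pole `l ≥ 7`;
reading (U): `Hex.cor312Of_lamSeven_<k>_all`), while over PRINT's `Ism` the same inequality holds at EXACTLY the three cells `(k, l) = (1, 5), (1, 7),
(1, 11)` (of which `(1, 7)` is a pole level, `7 ∣ 14`, presumably an EMPTY datum type; `(1, 11)` is INHABITED — gen 11's `Hex1.nonempty_and_…_eleven`)
and FAILS at every other `(k, l)`, `1 ≤ k ≤ 16`, `l ≥ 5` prime — in particular at all `5·24 = 120` inhabited tabulated rows `2 ≤ k ≤ 6` and at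
the 23 inhabited tabulated rows `k = 1`, `l ≥ 13`.

HONEST SCOPE. Statements about OUR typing of print's (Ind2) (`Real.ismIsm`, realised through the `p`-adic logarithm) inside the cell's L-DH
Corollary; decided-AS-TYPED, refuted-AS-TYPED ≠ in print; print's (Ind1) strip part (abc-iut-c312-1's rows R17/R18), (Ind3), the log-link and [IUTchIII]
Cor. 3.12 itself are untouched; admissibility / (P6) / non-emptiness is claimed ONLY where quoted from the junction of record. Nothing here
asserts [IUTchIII] Cor. 3.12, [IUTchIV] Thm. 1.10, or abc. [cite: Mochizuki2012, IUTchIII Cor. 3.12 p. 173–174, proof Step (x) p. 181; Thm. 3.11 (i)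
(Ind2) p. 154] [cite: Mochizuki2012, IUTchIV Thm. 1.10 Step (v) p. 27–28, Step (viii) p. 30; Cor. 2.2 (ii) proof (P6)(P7) p. 46] [claim: Mochizuki2012,
status: disputed] for every IUT quotation. PROOF-ONLY (no `def`, no new `Prop`, no instance, no notation). Records UNCHANGED (K p460293 · p460539 ·
p464272 · γ p462946; M twins): a decided print-Ism row moves no window-table cell and no certificate binder.
-/

noncomputable section

open NumberField IsDedekindDomain

namespace Literature.IUT.LogVolume.Cor22

open Summit.ABC.IUTFork Summit.ABC.IUTFork.Thm311.Real Literature.NumberTheory.NumberFields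
open Literature.NumberTheory.DiophantineGeometry Literature.NumberTheory.DiophantineGeometry.GenEll

namespace HexPrintIsm

/-! ## 1. The hex carriers lie in `U = ℙ¹ ∖ {0, 1, ∞}` -/

/-- `λ_k = 1/2 + 2/7^k ≠ 0`. [folklore] -/
theorem lamSeven_ne_zero (k : ℕ) : ((2 : ℚ)⁻¹ + 2 / 7 ^ k) ≠ 0 := by positivity

/-- `λ_k = 1/2 + 2/7^k ≠ 1` (`7^k ≠ 4`). [folklore] -/
theorem lamSeven_ne_one (k : ℕ) : ((2 : ℚ)⁻¹ + 2 / 7 ^ k) ≠ 1 := by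
  intro h
  rcases Nat.eq_zero_or_pos k with rfl | hk
  · norm_num at h
  · have h7 : (7 : ℚ) ≤ 7 ^ k := by
      calc (7 : ℚ) = 7 ^ 1 := by norm_num
        _ ≤ 7 ^ k := pow_le_pow_right₀ (by norm_num) hk
    have hpos : (0 : ℚ) < 7 ^ k := by positivity
    have h2 : (2 : ℚ) / 7 ^ k ≤ 2 / 7 := div_le_div_of_nonneg_left (by norm_num) (by norm_num) h7
    have h3 : (2 : ℚ) / 7 ^ k = 2⁻¹ := by linarith
    rw [h3] at h2
    norm_num at h2

/-- `ratPoint λ_k ∈ U`. [cite: MochizukiGenEll2010, Ex. 1.3 (i) p. 5] -/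
theorem inU_ratPoint_lamSeven (k : ℕ) : (ratPoint ((2 : ℚ)⁻¹ + 2 / 7 ^ k)).InU :=
  (ratPoint_mem_UPle_one (lamSeven_ne_zero k) (lamSeven_ne_one k)).1.1

/-! ## 2. FALSE ROWS: the whole family `2 ≤ k ≤ 16`, every prime level `l ≥ 5`, both readings -/

variable {k l : ℕ}

/-- **READING (P) over PRINT's (Ind2) FAILS on the HEX family `2 ≤ k ≤ 16` at EVERY level `l ≥ 5`**: for every genuine Θ-volume datum `T` over
`ratPoint (1/2 + 2/7^k)` at level `l` and every print-dominated family `H` of packet automorphisms, the per-image inequality with (Ind2) := print's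
factorwise `Ism` does NOT hold (part 7's criterion `perImage_printInd2_iff_shallow` against part 2's `not_shallow_lamSeven`; `l` is prime by
[IUTchI] Def. 3.1 (c), a field of the datum). [cite: Mochizuki2012, IUTchIII Cor. 3.12 p. 173–174; Thm. 3.11 (i) (Ind2) p. 154]
[claim: Mochizuki2012, status: disputed] -/
theorem not_perImage_printInd2_lamSeven (hk2 : 2 ≤ k) (hk : k ≤ 16) (h5 : 5 ≤ l)
    (T : ThetaVolumeDatumAt (ratPoint ((2 : ℚ)⁻¹ + 2 / 7 ^ k)) l) :
    letI := T.instFieldF; letI := T.instNumberFieldF; letI := T.instFieldK; letI := T.instNumberFieldK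
    letI := T.instAlgebraK; letI := T.instIsElliptic
    ∀ (H : (p : ℕ) → (hp : p.Prime) → (j : ℕ) →
        (e : Fin (j + 1) → placesOver (Literature.IUT.HodgeTheaters.fieldOfModuli T.E) p) →
        haveI : Fact p.Prime := ⟨hp⟩
        Subgroup (PacketAlgebra p (fun b => (T.I.σ.localFields p).k (e b)) ≃ₗ[ℚ_[p]]
          PacketAlgebra p (fun b => (T.I.σ.localFields p).k (e b)))),
      (∀ (p : ℕ) (hp : p.Prime), haveI : Fact p.Prime := ⟨hp⟩
        ∀ j e, ∀ g ∈ H p hp j e,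
          ∃ ψ : ∀ b : Fin (j + 1), Carrier (.inr (T.I.σ.lift (e b).1) : Thm311.Real.Place T.K) ≃ₗ[ℚ]
              Carrier (.inr (T.I.σ.lift (e b).1) : Thm311.Real.Place T.K),
            (∀ b, ψ b ∈ ismIsm (analyticLogv T.K) (T.I.σ.lift (e b).1)) ∧
            ∀ x : ∀ b, (T.I.σ.localFields p).k (e b),
              (g : PacketAlgebra p (fun b => (T.I.σ.localFields p).k (e b)) ≃ₗ[ℚ_[p]]
                  PacketAlgebra p (fun b => (T.I.σ.localFields p).k (e b))) (PiTensorProduct.tprod ℚ_[p] x) =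
                PiTensorProduct.tprod ℚ_[p] (fun b =>
                  RescaledCompletion.of T.K p (T.I.σ.lift (e b).1) (T.I.σ.natCast_mem_lift (e b))
                    (ψ b ((RescaledCompletion.of T.K p (T.I.σ.lift (e b).1) (T.I.σ.natCast_mem_lift (e b))).symm (x b))))) →
      ¬ (T.negAbsLogQ ≤
          (∑ p ∈ T.I.supportPrimes,
            if hp : p.Prime then
              (haveI : Fact p.Prime := ⟨hp⟩
               (T.I.packetAt p hp).lnνLp T.I.lstar (fun j e =>
                 packetHull p (fun b => (T.I.σ.localFields p).k (e b))
                   (⋃ g : H p hp j e, (g : PacketAlgebra p (fun b => (T.I.σ.localFields p).k (e b)) ≃ₗ[ℚ_[p]]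
                       PacketAlgebra p (fun b => (T.I.σ.localFields p).k (e b))) ''
                     (T.I.packetAt p hp).pilotRegion (T.I.tΘ p hp) j e)))
            else 0) + ThetaVolumeInput.archLogTheta l) := by
  intro H hH h
  have hl : l.Prime := by
    letI := T.instFieldF; letI := T.instNumberFieldF; letI := T.instAlgebraF; letI := T.instFieldK
    letI := T.instNumberFieldK; letI := T.instAlgebraK; letI := T.instFieldFbar; letI := T.instAlgebraFbar
    letI := T.instAlgebraKFbar; letI := T.instIsElliptic
    exact T.D.l_prime
  exact not_shallow_lamSeven hk2 hk hl h5 ((T.perImage_printInd2_iff_shallow (inU_ratPoint_lamSeven k) H hH).mp h)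

/-- The `j`-invariant of a datum over a RATIONAL point is rational (`j(E_F) = j(λ) ∈ ℚ`), so part 7's (U)-criterion applies. [folklore] -/
theorem j_mem_range_ratPoint {q : ℚ} (T : ThetaVolumeDatumAt (ratPoint q) l) :
    letI := T.instFieldF; letI := T.instNumberFieldF; letI := T.instIsElliptic
    T.E.j ∈ Set.range (algebraMap ℚ T.F) := by
  letI := T.instFieldF; letI := T.instNumberFieldF
  refine ⟨jInv q, ?_⟩
  rw [eq_ratCast, T.j_eq]
  exact (eq_ratCast _ _).symm

/-- **READING (U) over PRINT's (Ind2) FAILS on the HEX family `2 ≤ k ≤ 16` at EVERY level `l ≥ 5`** (rational `j`, so `[F_mod : ℚ] = 1` and the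
union criterion `union_printInd2_iff_shallow_of_j_mem_range` applies): for every datum and every print-dominated `H` the union inequality with
(Ind2) := print's factorwise `Ism` does NOT hold. [cite: Mochizuki2012, IUTchIII Cor. 3.12 p. 174; IUTchIV Thm. 1.10 Step (v) p. 27–28]
[claim: Mochizuki2012, status: disputed] -/
theorem not_union_printInd2_lamSeven (hk2 : 2 ≤ k) (hk : k ≤ 16) (h5 : 5 ≤ l)
    (T : ThetaVolumeDatumAt (ratPoint ((2 : ℚ)⁻¹ + 2 / 7 ^ k)) l) :
    letI := T.instFieldF; letI := T.instNumberFieldF; letI := T.instFieldK; letI := T.instNumberFieldK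
    letI := T.instAlgebraK; letI := T.instIsElliptic
    ∀ (H : (p : ℕ) → (hp : p.Prime) → (j : ℕ) →
        (e : Fin (j + 1) → placesOver (Literature.IUT.HodgeTheaters.fieldOfModuli T.E) p) →
        haveI : Fact p.Prime := ⟨hp⟩
        Subgroup (PacketAlgebra p (fun b => (T.I.σ.localFields p).k (e b)) ≃ₗ[ℚ_[p]]
          PacketAlgebra p (fun b => (T.I.σ.localFields p).k (e b)))),
      (∀ (p : ℕ) (hp : p.Prime), haveI : Fact p.Prime := ⟨hp⟩
        ∀ j e, ∀ g ∈ H p hp j e,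
          ∃ ψ : ∀ b : Fin (j + 1), Carrier (.inr (T.I.σ.lift (e b).1) : Thm311.Real.Place T.K) ≃ₗ[ℚ]
              Carrier (.inr (T.I.σ.lift (e b).1) : Thm311.Real.Place T.K),
            (∀ b, ψ b ∈ ismIsm (analyticLogv T.K) (T.I.σ.lift (e b).1)) ∧
            ∀ x : ∀ b, (T.I.σ.localFields p).k (e b),
              (g : PacketAlgebra p (fun b => (T.I.σ.localFields p).k (e b)) ≃ₗ[ℚ_[p]]
                  PacketAlgebra p (fun b => (T.I.σ.localFields p).k (e b))) (PiTensorProduct.tprod ℚ_[p] x) =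
                PiTensorProduct.tprod ℚ_[p] (fun b =>
                  RescaledCompletion.of T.K p (T.I.σ.lift (e b).1) (T.I.σ.natCast_mem_lift (e b))
                    (ψ b ((RescaledCompletion.of T.K p (T.I.σ.lift (e b).1) (T.I.σ.natCast_mem_lift (e b))).symm (x b))))) →
      ¬ (T.negAbsLogQ ≤
          (∑ p ∈ T.I.supportPrimes,
            if hp : p.Prime then
              (haveI : Fact p.Prime := ⟨hp⟩
               (T.I.packetAt p hp).lnνLp T.I.lstar (fun j e =>
                 packetHull p (fun b => (T.I.σ.localFields p).k (e b))
                   (⋃ g : H p hp j e, (g : PacketAlgebra p (fun b => (T.I.σ.localFields p).k (e b)) ≃ₗ[ℚ_[p]]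
                       PacketAlgebra p (fun b => (T.I.σ.localFields p).k (e b))) ''
                     ⋃ τ : Equiv.Perm (Fin (j + 1)), (T.I.packetAt p hp).perm τ e ''
                       (T.I.packetAt p hp).pilotRegion (T.I.tΘ p hp) j (e ∘ τ))))
            else 0) + ThetaVolumeInput.archLogTheta l) := by
  intro H hH h
  have hl : l.Prime := by
    letI := T.instFieldF; letI := T.instNumberFieldF; letI := T.instAlgebraF; letI := T.instFieldK
    letI := T.instNumberFieldK; letI := T.instAlgebraK; letI := T.instFieldFbar; letI := T.instAlgebraFbar
    letI := T.instAlgebraKFbar; letI := T.instIsElliptic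
    exact T.D.l_prime
  exact not_shallow_lamSeven hk2 hk hl h5
    ((T.union_printInd2_iff_shallow_of_j_mem_range (inU_ratPoint_lamSeven k) (j_mem_range_ratPoint T) H hH).mp h)

/-- **NON-VACUITY at the tabulated rows `2 ≤ k ≤ 6`**: at each of the 24 TABULATED levels `11 ≤ l ≤ 107` of the (U) junction of record
(`Conditional.Hex.nonempty_and_cor312Of_lamSeven_le_six_tabulated`: type INHABITED ∧ CONTAINER reading `T.Cor312Of` for every datum) the datum
type is inhabited AND the union inequality over PRINT's (Ind2) FAILS for every datum and every print-dominated `H`. [cite: Mochizuki2012, IUTchIII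
Cor. 3.12 p. 174; IUTchIV Cor. 2.2 (ii) proof (P6)(P7) p. 46] [claim: Mochizuki2012, status: disputed] -/
theorem nonempty_and_not_union_printInd2_lamSeven_tabulated (hk : 2 ≤ k ∧ k ≤ 6) :
    ∀ l ∈ ([11, 13, 17, 19, 23, 29, 31, 37, 41, 43, 47, 53, 59, 61, 67, 71, 73, 79, 83, 89, 97, 101, 103, 107] : List ℕ),
      Nonempty (ThetaVolumeDatumAt (ratPoint ((2 : ℚ)⁻¹ + 2 / 7 ^ k)) l) ∧
      ∀ T : ThetaVolumeDatumAt (ratPoint ((2 : ℚ)⁻¹ + 2 / 7 ^ k)) l,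
      letI := T.instFieldF; letI := T.instNumberFieldF; letI := T.instFieldK; letI := T.instNumberFieldK
      letI := T.instAlgebraK; letI := T.instIsElliptic
      ∀ (H : (p : ℕ) → (hp : p.Prime) → (j : ℕ) →
          (e : Fin (j + 1) → placesOver (Literature.IUT.HodgeTheaters.fieldOfModuli T.E) p) →
          haveI : Fact p.Prime := ⟨hp⟩
          Subgroup (PacketAlgebra p (fun b => (T.I.σ.localFields p).k (e b)) ≃ₗ[ℚ_[p]]
            PacketAlgebra p (fun b => (T.I.σ.localFields p).k (e b)))),
        (∀ (p : ℕ) (hp : p.Prime), haveI : Fact p.Prime := ⟨hp⟩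
          ∀ j e, ∀ g ∈ H p hp j e,
            ∃ ψ : ∀ b : Fin (j + 1), Carrier (.inr (T.I.σ.lift (e b).1) : Thm311.Real.Place T.K) ≃ₗ[ℚ]
                Carrier (.inr (T.I.σ.lift (e b).1) : Thm311.Real.Place T.K),
              (∀ b, ψ b ∈ ismIsm (analyticLogv T.K) (T.I.σ.lift (e b).1)) ∧
              ∀ x : ∀ b, (T.I.σ.localFields p).k (e b),
                (g : PacketAlgebra p (fun b => (T.I.σ.localFields p).k (e b)) ≃ₗ[ℚ_[p]]
                    PacketAlgebra p (fun b => (T.I.σ.localFields p).k (e b))) (PiTensorProduct.tprod ℚ_[p] x) =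
                  PiTensorProduct.tprod ℚ_[p] (fun b =>
                    RescaledCompletion.of T.K p (T.I.σ.lift (e b).1) (T.I.σ.natCast_mem_lift (e b))
                      (ψ b ((RescaledCompletion.of T.K p (T.I.σ.lift (e b).1) (T.I.σ.natCast_mem_lift (e b))).symm (x b))))) →
        ¬ (T.negAbsLogQ ≤
            (∑ p ∈ T.I.supportPrimes,
              if hp : p.Prime then
                (haveI : Fact p.Prime := ⟨hp⟩
                 (T.I.packetAt p hp).lnνLp T.I.lstar (fun j e =>
                   packetHull p (fun b => (T.I.σ.localFields p).k (e b))
                     (⋃ g : H p hp j e, (g : PacketAlgebra p (fun b => (T.I.σ.localFields p).k (e b)) ≃ₗ[ℚ_[p]]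
                         PacketAlgebra p (fun b => (T.I.σ.localFields p).k (e b))) ''
                       ⋃ τ : Equiv.Perm (Fin (j + 1)), (T.I.packetAt p hp).perm τ e ''
                         (T.I.packetAt p hp).pilotRegion (T.I.tΘ p hp) j (e ∘ τ))))
              else 0) + ThetaVolumeInput.archLogTheta l) := by
  intro l hl
  have hside : ∀ l ∈ ([11, 13, 17, 19, 23, 29, 31, 37, 41, 43, 47, 53, 59, 61, 67, 71, 73, 79, 83, 89, 97, 101, 103, 107] : List ℕ),
      5 ≤ l := by decide
  exact ⟨(Conditional.Hex.nonempty_and_cor312Of_lamSeven_le_six_tabulated ⟨by omega, hk.2⟩ l hl).1,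
    fun T => not_union_printInd2_lamSeven hk.1 (by omega) (hside l hl) T⟩

/-! ## 3. `k = 1` (`λ = 11/14`): the readings over print's (Ind2) hold IFF `l ≤ 11` -/

/-- **READING (P), `k = 1`: for every `l ≥ 5`, every genuine Θ-volume datum over `ratPoint (11/14)` at level `l` and every print-dominated `H`,
the per-image inequality over PRINT's (Ind2) holds IFF `l ≤ 11`** (part 2's `shallow_hexOne_iff`; TRUE cells `l ∈ {5, 7, 11}` — `l = 11` inhabited,
gen 11's `Hex1.nonempty_and_perImage_printInd2_eleven`; `l = 7` divides `14`). [cite: Mochizuki2012, IUTchIII Cor. 3.12 p. 173–174; Thm. 3.11 (i)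
(Ind2) p. 154] [claim: Mochizuki2012, status: disputed] -/
theorem perImage_printInd2_hexOne_iff (h5 : 5 ≤ l) (T : ThetaVolumeDatumAt (ratPoint ((11 : ℚ) / 14)) l) :
    letI := T.instFieldF; letI := T.instNumberFieldF; letI := T.instFieldK; letI := T.instNumberFieldK
    letI := T.instAlgebraK; letI := T.instIsElliptic
    ∀ (H : (p : ℕ) → (hp : p.Prime) → (j : ℕ) →
        (e : Fin (j + 1) → placesOver (Literature.IUT.HodgeTheaters.fieldOfModuli T.E) p) →
        haveI : Fact p.Prime := ⟨hp⟩
        Subgroup (PacketAlgebra p (fun b => (T.I.σ.localFields p).k (e b)) ≃ₗ[ℚ_[p]]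
          PacketAlgebra p (fun b => (T.I.σ.localFields p).k (e b)))),
      (∀ (p : ℕ) (hp : p.Prime), haveI : Fact p.Prime := ⟨hp⟩
        ∀ j e, ∀ g ∈ H p hp j e,
          ∃ ψ : ∀ b : Fin (j + 1), Carrier (.inr (T.I.σ.lift (e b).1) : Thm311.Real.Place T.K) ≃ₗ[ℚ]
              Carrier (.inr (T.I.σ.lift (e b).1) : Thm311.Real.Place T.K),
            (∀ b, ψ b ∈ ismIsm (analyticLogv T.K) (T.I.σ.lift (e b).1)) ∧
            ∀ x : ∀ b, (T.I.σ.localFields p).k (e b),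
              (g : PacketAlgebra p (fun b => (T.I.σ.localFields p).k (e b)) ≃ₗ[ℚ_[p]]
                  PacketAlgebra p (fun b => (T.I.σ.localFields p).k (e b))) (PiTensorProduct.tprod ℚ_[p] x) =
                PiTensorProduct.tprod ℚ_[p] (fun b =>
                  RescaledCompletion.of T.K p (T.I.σ.lift (e b).1) (T.I.σ.natCast_mem_lift (e b))
                    (ψ b ((RescaledCompletion.of T.K p (T.I.σ.lift (e b).1) (T.I.σ.natCast_mem_lift (e b))).symm (x b))))) →
      ((T.negAbsLogQ ≤
          (∑ p ∈ T.I.supportPrimes,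
            if hp : p.Prime then
              (haveI : Fact p.Prime := ⟨hp⟩
               (T.I.packetAt p hp).lnνLp T.I.lstar (fun j e =>
                 packetHull p (fun b => (T.I.σ.localFields p).k (e b))
                   (⋃ g : H p hp j e, (g : PacketAlgebra p (fun b => (T.I.σ.localFields p).k (e b)) ≃ₗ[ℚ_[p]]
                       PacketAlgebra p (fun b => (T.I.σ.localFields p).k (e b))) ''
                     (T.I.packetAt p hp).pilotRegion (T.I.tΘ p hp) j e)))
            else 0) + ThetaVolumeInput.archLogTheta l) ↔ l ≤ 11) := by
  intro H hH
  have hl : l.Prime := by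
    letI := T.instFieldF; letI := T.instNumberFieldF; letI := T.instAlgebraF; letI := T.instFieldK
    letI := T.instNumberFieldK; letI := T.instAlgebraK; letI := T.instFieldFbar; letI := T.instAlgebraFbar
    letI := T.instAlgebraKFbar; letI := T.instIsElliptic
    exact T.D.l_prime
  exact (T.perImage_printInd2_iff_shallow (ratPoint_mem_UPle_one (by norm_num) (by norm_num)).1.1 H hH).trans
    (shallow_hexOne_iff hl h5)

/-- **READING (U), `k = 1`: for every `l ≥ 5`, every datum over `ratPoint (11/14)` and every print-dominated `H`, the union inequality over PRINT's
(Ind2) holds IFF `l ≤ 11`.** [cite: Mochizuki2012, IUTchIII Cor. 3.12 p. 174; IUTchIV Thm. 1.10 Step (v) p. 27–28] [claim: Mochizuki2012, status: disputed] -/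
theorem union_printInd2_hexOne_iff (h5 : 5 ≤ l) (T : ThetaVolumeDatumAt (ratPoint ((11 : ℚ) / 14)) l) :
    letI := T.instFieldF; letI := T.instNumberFieldF; letI := T.instFieldK; letI := T.instNumberFieldK
    letI := T.instAlgebraK; letI := T.instIsElliptic
    ∀ (H : (p : ℕ) → (hp : p.Prime) → (j : ℕ) →
        (e : Fin (j + 1) → placesOver (Literature.IUT.HodgeTheaters.fieldOfModuli T.E) p) →
        haveI : Fact p.Prime := ⟨hp⟩
        Subgroup (PacketAlgebra p (fun b => (T.I.σ.localFields p).k (e b)) ≃ₗ[ℚ_[p]]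
          PacketAlgebra p (fun b => (T.I.σ.localFields p).k (e b)))),
      (∀ (p : ℕ) (hp : p.Prime), haveI : Fact p.Prime := ⟨hp⟩
        ∀ j e, ∀ g ∈ H p hp j e,
          ∃ ψ : ∀ b : Fin (j + 1), Carrier (.inr (T.I.σ.lift (e b).1) : Thm311.Real.Place T.K) ≃ₗ[ℚ]
              Carrier (.inr (T.I.σ.lift (e b).1) : Thm311.Real.Place T.K),
            (∀ b, ψ b ∈ ismIsm (analyticLogv T.K) (T.I.σ.lift (e b).1)) ∧
            ∀ x : ∀ b, (T.I.σ.localFields p).k (e b),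
              (g : PacketAlgebra p (fun b => (T.I.σ.localFields p).k (e b)) ≃ₗ[ℚ_[p]]
                  PacketAlgebra p (fun b => (T.I.σ.localFields p).k (e b))) (PiTensorProduct.tprod ℚ_[p] x) =
                PiTensorProduct.tprod ℚ_[p] (fun b =>
                  RescaledCompletion.of T.K p (T.I.σ.lift (e b).1) (T.I.σ.natCast_mem_lift (e b))
                    (ψ b ((RescaledCompletion.of T.K p (T.I.σ.lift (e b).1) (T.I.σ.natCast_mem_lift (e b))).symm (x b))))) →
      ((T.negAbsLogQ ≤
          (∑ p ∈ T.I.supportPrimes,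
            if hp : p.Prime then
              (haveI : Fact p.Prime := ⟨hp⟩
               (T.I.packetAt p hp).lnνLp T.I.lstar (fun j e =>
                 packetHull p (fun b => (T.I.σ.localFields p).k (e b))
                   (⋃ g : H p hp j e, (g : PacketAlgebra p (fun b => (T.I.σ.localFields p).k (e b)) ≃ₗ[ℚ_[p]]
                       PacketAlgebra p (fun b => (T.I.σ.localFields p).k (e b))) ''
                     ⋃ τ : Equiv.Perm (Fin (j + 1)), (T.I.packetAt p hp).perm τ e ''
                       (T.I.packetAt p hp).pilotRegion (T.I.tΘ p hp) j (e ∘ τ))))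
            else 0) + ThetaVolumeInput.archLogTheta l) ↔ l ≤ 11) := by
  intro H hH
  have hl : l.Prime := by
    letI := T.instFieldF; letI := T.instNumberFieldF; letI := T.instAlgebraF; letI := T.instFieldK
    letI := T.instNumberFieldK; letI := T.instAlgebraK; letI := T.instFieldFbar; letI := T.instAlgebraFbar
    letI := T.instAlgebraKFbar; letI := T.instIsElliptic
    exact T.D.l_prime
  exact (T.union_printInd2_iff_shallow_of_j_mem_range (ratPoint_mem_UPle_one (by norm_num) (by norm_num)).1.1
    (j_mem_range_ratPoint T) H hH).trans (shallow_hexOne_iff hl h5)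

end HexPrintIsm

end Literature.IUT.LogVolume.Cor22

end
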